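import Summits.QuantumFields.QCD.Theorems.WilsonMobilityGapMobilityGapSketchWindow
import Summits.QuantumFields.QCD.Theorems.ExtinctionBuildsQCD.Negative.WithoutTightCollapse
import Summits.QuantumFields.QCD.Theorems.SpectralDefectExtinctionTipPricingStubCoareaExpectation
import Summits.QuantumFields.QCD.Theorems.SpectralDefectExtinctionTipPricingStubCoareaPointwise
import Summits.QuantumFields.QCD.Theorems.SpectralDefectExtinctionTipPricingStubCountMeasurable

/-!
# `stub_windowAt` (skeleton v5, line `Sketch`, crux stmt-QuantumFields-9150) — AUDIT + REDUCTION evidence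

Stub-worker W3 audit of the registered stub `stub_windowAt` (skeleton v5/v6), landed by the lead as the helper proving the
registered sub-goal `windowLaw_of_windowDOSLaw_two` (§R, last theorem).  Kernel-checked facts (also backing the evidence
note `stub_windowAt-DIAG.md` on the crux item):

* §A audit: the `∃ L`-prefix is inhabited by the floor (`windowAt_prefix_inhabited`); the window count
  vanishes on the degenerate diagonal (`windowCount_eq_zero_of_eq`) and for window pairs with
  `0 ≤ min t` (`windowCount_eq_zero_of_nonneg`, real spectrum of `D_W(U,0,1)` in `[0,8]`), so the body of
  the stub is `0 ≤ 1/4` there (`windowBody_of_nonneg`): content only while `thrD d δ k < 0`.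
* §R reduction to WEGNER FORM (the most specific statement the stub hinges on): by the LANDED coarea line
  of crux `TipPricing` (`stub_coareaPointwise`, `stub_countMeasurable`, `stub_coareaExpectation`), the
  phase-quenched expected window count is bounded by the `t`-integrated zero-window density of states of
  the HERMITIAN Wilson operator `H_U(s) = γ₅ D_W(U,−s,1)` across the spread window; hence the stub follows
  from the DOS-form law `WindowDOSAt` (unfolded in `windowAt_of_windowDOSAt`), torus by torus
  (`windowBody_le_of_windowDOS`).
-/

noncomputable section

namespace Summit.QuantumFields.QCD.Theorems.MobilityGapSketch

open scoped BigOperators Topology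
open MeasureTheory Filter Set
open Literature.MathematicalPhysics.QuantumFieldTheory Literature.MathematicalPhysics.QuantumLattice
  Literature.Probability.LatticeModels

/-! ### §A Audit facts -/

/-- A1. The `∃ L`-prefix of `stub_windowAt` is inhabited by the volume floor itself. -/
theorem windowAt_prefix_inhabited {Nf : ℕ} (d : LineData Nf) :
    ∃ L : ℕ → ℕ, Tendsto (fun k => d.a k * (L k : ℝ)) atTop atTop ∧ (∀ᶠ k in atTop, d.vfloor k ≤ L k) :=
  ⟨d.vfloor, d.tendsto_a_mul_vfloor, Eventually.of_forall fun _ => le_rfl⟩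

variable {N : ℕ} [NeZero N]

/-- A2. Degenerate diagonal: for `t 0 = t 1` the spread window is empty, the count is `0`. -/
theorem windowCount_eq_zero_of_eq (U : GaugeConfig 4 N (Matrix.specialUnitaryGroup (Fin 3) ℂ))
    (t : Fin 2 → ℝ) (ht : t 0 = t 1) :
    (wilsonDirac (fundamentalRep (Fin 3)) U 0 1).charpoly.roots.countP
      (fun z : ℂ => z.im = 0 ∧ -max (t 0) (t 1) < z.re ∧ z.re < -min (t 0) (t 1)) = 0 := by
  rw [Multiset.countP_eq_zero]
  rintro z - ⟨-, h1, h2⟩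
  rw [ht, max_self] at h1
  rw [ht, min_self] at h2
  linarith

/-- A3. Window pairs with `0 ≤ min t`: the window `(−max t, −min t) ⊂ (−∞, 0]` misses the real spectrum of
`D_W(U,0,1)`, which lies in `[0,8]` (landed `re_mem_Icc_of_real_root`) — except possibly `re = 0`, excluded
by the strict inequality `re < −min t ≤ 0`.  So the count is `0`. -/
theorem windowCount_eq_zero_of_nonneg (U : GaugeConfig 4 N (Matrix.specialUnitaryGroup (Fin 3) ℂ))
    (t : Fin 2 → ℝ) (ht : 0 ≤ min (t 0) (t 1)) :
    (wilsonDirac (fundamentalRep (Fin 3)) U 0 1).charpoly.roots.countP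
      (fun z : ℂ => z.im = 0 ∧ -max (t 0) (t 1) < z.re ∧ z.re < -min (t 0) (t 1)) = 0 := by
  rw [Multiset.countP_eq_zero]
  rintro z hz ⟨hzim, -, h2⟩
  have := (ExtinctionBuildsQCD.Negative.re_mem_Icc_of_real_root U hz hzim).1
  linarith

/-- A4. Hence the BODY of `stub_windowAt` holds with value `0 ≤ 1/4` at every window pair with `0 ≤ min t`
(in particular whenever `0 ≤ thrD d δ k`): the stub has content only while the threshold is negative. -/
theorem windowBody_of_nonneg (β : ℝ) (t : Fin 2 → ℝ) (ht : 0 ≤ min (t 0) (t 1)) :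
    (∫ U : GaugeConfig 4 N (Matrix.specialUnitaryGroup (Fin 3) ℂ),
        ((wilsonDirac (fundamentalRep (Fin 3)) U 0 1).charpoly.roots.countP
            (fun z : ℂ => z.im = 0 ∧ -max (t 0) (t 1) < z.re ∧ z.re < -min (t 0) (t 1)) : ℝ) *
          ∏ f : Fin 2, ‖fermionDet (wilsonDirac (fundamentalRep (Fin 3)) U (t f) 1)‖
        ∂(wilsonMeasure (d := 4) (L := N) (fundamentalRep (Fin 3)) β)) /
      (∫ U : GaugeConfig 4 N (Matrix.specialUnitaryGroup (Fin 3) ℂ),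
        ∏ f : Fin 2, ‖fermionDet (wilsonDirac (fundamentalRep (Fin 3)) U (t f) 1)‖
        ∂(wilsonMeasure (d := 4) (L := N) (fundamentalRep (Fin 3)) β)) ≤ 1 / 4 := by
  have h0 : (fun U : GaugeConfig 4 N (Matrix.specialUnitaryGroup (Fin 3) ℂ) =>
      ((wilsonDirac (fundamentalRep (Fin 3)) U 0 1).charpoly.roots.countP
          (fun z : ℂ => z.im = 0 ∧ -max (t 0) (t 1) < z.re ∧ z.re < -min (t 0) (t 1)) : ℝ) *
        ∏ f : Fin 2, ‖fermionDet (wilsonDirac (fundamentalRep (Fin 3)) U (t f) 1)‖) = fun _ => 0 := by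
    funext U
    rw [windowCount_eq_zero_of_nonneg U t ht, Nat.cast_zero, zero_mul]
  rw [h0, integral_zero, zero_div]
  norm_num

/-! ### §R Reduction to Wegner (density-of-states) form via the landed coarea line -/

/-- R1 (one torus, one coupling, one pair). If the `t`-integrated phase-quenched zero-window level count of
the Hermitian Wilson operator `H_U(s) = γ₅ D_W(U,−s,1)` across the spread window `(−max t, −min t)` is
`≤ 2η·B` for all small `η > 0`, then the phase-quenched expected number of real eigenvalues of `D_W(U,0,1)`
in the window is `≤ B` (coarea inequality of the landed `TipPricing` line: `stub_coareaPointwise`,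
`stub_countMeasurable`, `stub_coareaExpectation`; the slack `δ` is sent to `0`). -/
theorem windowIntegral_le_of_windowDOS (β : ℝ) (t : Fin 2 → ℝ) (B : ℝ)
    (hDOS : ∃ η₀ : ℝ, 0 < η₀ ∧ ∀ η : ℝ, 0 < η → η < η₀ →
      (∫ s in (-max (t 0) (t 1))..(-min (t 0) (t 1)),
          ∫ U : GaugeConfig 4 N (Matrix.specialUnitaryGroup (Fin 3) ℂ),
            ((spinorLift gammaFive * wilsonDirac (fundamentalRep (Fin 3)) U (-s) 1).charpoly.roots.countP
                (fun z : ℂ => |z.re| < η) : ℝ) *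
              ∏ f : Fin 2, ‖fermionDet (wilsonDirac (fundamentalRep (Fin 3)) U (t f) 1)‖
            ∂(wilsonMeasure (d := 4) (L := N) (fundamentalRep (Fin 3)) β)) ≤ 2 * η * B) :
    (∫ U : GaugeConfig 4 N (Matrix.specialUnitaryGroup (Fin 3) ℂ),
        ((wilsonDirac (fundamentalRep (Fin 3)) U 0 1).charpoly.roots.countP
            (fun z : ℂ => z.im = 0 ∧ -max (t 0) (t 1) < z.re ∧ z.re < -min (t 0) (t 1)) : ℝ) *
          ∏ f : Fin 2, ‖fermionDet (wilsonDirac (fundamentalRep (Fin 3)) U (t f) 1)‖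
        ∂(wilsonMeasure (d := 4) (L := N) (fundamentalRep (Fin 3)) β)) ≤ B := by
  obtain ⟨η₀, hη₀, hD⟩ := hDOS
  set w : GaugeConfig 4 N (Matrix.specialUnitaryGroup (Fin 3) ℂ) → ℝ := fun U =>
    ∏ f : Fin 2, ‖fermionDet (wilsonDirac (fundamentalRep (Fin 3)) U (t f) 1)‖ with hw
  have hwc : Continuous w := by
    have : w = fun U => ‖(diracMatrix U t).det‖ := funext fun U => (norm_det_diracMatrix U t).symm
    rw [this]
    exact (continuous_det_diracMatrix t).norm
  have hw0 : ∀ U, 0 ≤ w U := fun U => Finset.prod_nonneg fun f _ => norm_nonneg _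
  rcases lt_or_ge (-max (t 0) (t 1)) (-min (t 0) (t 1)) with hlt | hle
  · -- non-degenerate window: coarea inequality, then `δ → 0`
    have hco := Summit.QuantumFields.QCD.Cruxes.TipPricing.HermitianFlowCoarea.stub_coareaExpectation
      Summit.QuantumFields.QCD.Cruxes.TipPricing.HermitianFlowCoarea.stub_coareaPointwise
      Summit.QuantumFields.QCD.Cruxes.TipPricing.HermitianFlowCoarea.stub_countMeasurable
      N β w hwc hw0 _ _ hlt
    refine le_of_forall_pos_lt_add fun δ hδ => ?_
    obtain ⟨η₁, hη₁, hco'⟩ := hco (δ / 2) (half_pos hδ)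
    set η := min η₀ η₁ / 2 with hη
    have hηpos : 0 < η := by positivity
    have hη0 : η < η₀ := by
      have := min_le_left η₀ η₁; rw [hη]; linarith
    have hη1 : η < η₁ := by
      have := min_le_right η₀ η₁; rw [hη]; linarith
    have h1 := hco' η hηpos hη1
    have h2 : (∫ s in (-max (t 0) (t 1))..(-min (t 0) (t 1)),
        ∫ U : GaugeConfig 4 N (Matrix.specialUnitaryGroup (Fin 3) ℂ),
          ((spinorLift gammaFive * wilsonDirac (fundamentalRep (Fin 3)) U (-s) 1).charpoly.roots.countP
              (fun z : ℂ => |z.re| < η) : ℝ) * w U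
          ∂(wilsonMeasure (d := 4) (L := N) (fundamentalRep (Fin 3)) β)) ≤ 2 * η * B := hD η hηpos hη0
    have h3 : 2 * η * (∫ U, ((wilsonDirac (fundamentalRep (Fin 3)) U 0 1).charpoly.roots.countP
        (fun z : ℂ => z.im = 0 ∧ -max (t 0) (t 1) < z.re ∧ z.re < -min (t 0) (t 1)) : ℝ) * w U
        ∂(wilsonMeasure (d := 4) (L := N) (fundamentalRep (Fin 3)) β)) ≤ 2 * η * (B + δ / 2) := by
      linarith
    have h4 := le_of_mul_le_mul_left h3 (by positivity)
    linarith
  · -- degenerate window (`min t = max t`): the count vanishes and `0 ≤ B` is forced by the hypothesis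
    have hminmax : min (t 0) (t 1) = max (t 0) (t 1) := le_antisymm min_le_max (by linarith)
    have hcount : ∀ U : GaugeConfig 4 N (Matrix.specialUnitaryGroup (Fin 3) ℂ),
        (wilsonDirac (fundamentalRep (Fin 3)) U 0 1).charpoly.roots.countP
          (fun z : ℂ => z.im = 0 ∧ -max (t 0) (t 1) < z.re ∧ z.re < -min (t 0) (t 1)) = 0 := by
      intro U
      rw [Multiset.countP_eq_zero]
      rintro z - ⟨-, h1, h2⟩
      rw [hminmax] at h2
      linarith
    have hB : 0 ≤ B := by
      have h2 := hD (η₀ / 2) (half_pos hη₀) (by linarith)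
      rw [hminmax, intervalIntegral.integral_same] at h2
      nlinarith
    calc (∫ U, ((wilsonDirac (fundamentalRep (Fin 3)) U 0 1).charpoly.roots.countP
          (fun z : ℂ => z.im = 0 ∧ -max (t 0) (t 1) < z.re ∧ z.re < -min (t 0) (t 1)) : ℝ) * w U
          ∂(wilsonMeasure (d := 4) (L := N) (fundamentalRep (Fin 3)) β))
        = ∫ U : GaugeConfig 4 N (Matrix.specialUnitaryGroup (Fin 3) ℂ), (0 : ℝ)
          ∂(wilsonMeasure (d := 4) (L := N) (fundamentalRep (Fin 3)) β) :=
          integral_congr_ae (Eventually.of_forall fun U => by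
            simp only [hcount U, Nat.cast_zero, zero_mul])
      _ = 0 := integral_zero _ _
      _ ≤ B := hB

/-- R2 (one torus). DOS form ⟹ the body of `stub_windowAt`: if the normalised `t`-integrated zero-window
DOS across the spread window is `≤ 2η · (1/4)` for all small `η`, the normalised expected window count is
`≤ 1/4` (`Z₊ > 0` by `integral_norm_det_diracMatrix_pos_all`). -/
theorem windowBody_le_of_windowDOS (β : ℝ) (t : Fin 2 → ℝ)
    (hDOS : ∃ η₀ : ℝ, 0 < η₀ ∧ ∀ η : ℝ, 0 < η → η < η₀ →
      (∫ s in (-max (t 0) (t 1))..(-min (t 0) (t 1)),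
          ∫ U : GaugeConfig 4 N (Matrix.specialUnitaryGroup (Fin 3) ℂ),
            ((spinorLift gammaFive * wilsonDirac (fundamentalRep (Fin 3)) U (-s) 1).charpoly.roots.countP
                (fun z : ℂ => |z.re| < η) : ℝ) *
              ∏ f : Fin 2, ‖fermionDet (wilsonDirac (fundamentalRep (Fin 3)) U (t f) 1)‖
            ∂(wilsonMeasure (d := 4) (L := N) (fundamentalRep (Fin 3)) β)) /
        (∫ U : GaugeConfig 4 N (Matrix.specialUnitaryGroup (Fin 3) ℂ),
          ∏ f : Fin 2, ‖fermionDet (wilsonDirac (fundamentalRep (Fin 3)) U (t f) 1)‖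
          ∂(wilsonMeasure (d := 4) (L := N) (fundamentalRep (Fin 3)) β)) ≤ 2 * η * (1 / 4)) :
    (∫ U : GaugeConfig 4 N (Matrix.specialUnitaryGroup (Fin 3) ℂ),
        ((wilsonDirac (fundamentalRep (Fin 3)) U 0 1).charpoly.roots.countP
            (fun z : ℂ => z.im = 0 ∧ -max (t 0) (t 1) < z.re ∧ z.re < -min (t 0) (t 1)) : ℝ) *
          ∏ f : Fin 2, ‖fermionDet (wilsonDirac (fundamentalRep (Fin 3)) U (t f) 1)‖
        ∂(wilsonMeasure (d := 4) (L := N) (fundamentalRep (Fin 3)) β)) /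
      (∫ U : GaugeConfig 4 N (Matrix.specialUnitaryGroup (Fin 3) ℂ),
        ∏ f : Fin 2, ‖fermionDet (wilsonDirac (fundamentalRep (Fin 3)) U (t f) 1)‖
        ∂(wilsonMeasure (d := 4) (L := N) (fundamentalRep (Fin 3)) β)) ≤ 1 / 4 := by
  set Z := ∫ U : GaugeConfig 4 N (Matrix.specialUnitaryGroup (Fin 3) ℂ),
    ∏ f : Fin 2, ‖fermionDet (wilsonDirac (fundamentalRep (Fin 3)) U (t f) 1)‖
    ∂(wilsonMeasure (d := 4) (L := N) (fundamentalRep (Fin 3)) β) with hZdef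
  have hZeq : Z = ∫ U : GaugeConfig 4 N (Matrix.specialUnitaryGroup (Fin 3) ℂ), ‖(diracMatrix U t).det‖
      ∂(wilsonMeasure (d := 4) (L := N) (fundamentalRep (Fin 3)) β) :=
    integral_congr_ae (Eventually.of_forall fun U => (norm_det_diracMatrix U t).symm)
  have hZ : 0 < Z := by rw [hZeq]; exact integral_norm_det_diracMatrix_pos_all β t
  rw [div_le_iff₀ hZ]
  refine windowIntegral_le_of_windowDOS β t (1 / 4 * Z) ?_
  obtain ⟨η₀, hη₀, hD⟩ := hDOS
  refine ⟨η₀, hη₀, fun η hη hηlt => ?_⟩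
  have := hD η hη hηlt
  rw [div_le_iff₀ hZ] at this
  linarith

/-- R3 (along a free two-flavour datum). **`stub_windowAt` follows from its WEGNER FORM**: if on some
admissible volume sequence `L ≥ L⁰`, for every large `δ`, every `M > 0`, eventually in `k`, for every window
pair `t` the normalised `t`-integrated phase-quenched zero-window DOS of `γ₅ D_W(U,−s,1)` across the spread
window `(−max t, −min t)` (bare width `≤ a_k M/Z_m(k)`) on the torus of side `2L_k+1` at coupling `β_k` is
`≤ 2η/4` for all small `η > 0`, then the conclusion of `stub_windowAt` holds for `d` (same `L`). -/
theorem windowAt_of_windowDOSAt {d : LineData 2}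
    (h : ∃ L : ℕ → ℕ, Tendsto (fun k => d.a k * (L k : ℝ)) atTop atTop ∧ (∀ᶠ k in atTop, d.vfloor k ≤ L k) ∧
      ∀ᶠ δ in atTop, ∀ M : ℝ, 0 < M → ∀ᶠ k in atTop,
        (floorSetD d δ k).Nonempty → -1 < thrD d δ k → ∀ t : Fin 2 → ℝ,
          (∀ f, thrD d δ k < t f) → (∀ f, t f ≤ thrD d δ k + d.a k * M / d.zm k) →
            ∃ η₀ : ℝ, 0 < η₀ ∧ ∀ η : ℝ, 0 < η → η < η₀ →
              (∫ s in (-max (t 0) (t 1))..(-min (t 0) (t 1)),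
                  ∫ U : GaugeConfig 4 (2 * L k + 1) (Matrix.specialUnitaryGroup (Fin 3) ℂ),
                    ((spinorLift gammaFive * wilsonDirac (fundamentalRep (Fin 3)) U (-s) 1).charpoly.roots.countP
                        (fun z : ℂ => |z.re| < η) : ℝ) *
                      ∏ f : Fin 2, ‖fermionDet (wilsonDirac (fundamentalRep (Fin 3)) U (t f) 1)‖
                    ∂(wilsonMeasure (d := 4) (L := 2 * L k + 1) (fundamentalRep (Fin 3)) (d.β k))) /
                (∫ U : GaugeConfig 4 (2 * L k + 1) (Matrix.specialUnitaryGroup (Fin 3) ℂ),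
                  ∏ f : Fin 2, ‖fermionDet (wilsonDirac (fundamentalRep (Fin 3)) U (t f) 1)‖
                  ∂(wilsonMeasure (d := 4) (L := 2 * L k + 1) (fundamentalRep (Fin 3)) (d.β k))) ≤
                2 * η * (1 / 4)) :
    ∃ L : ℕ → ℕ, Tendsto (fun k => d.a k * (L k : ℝ)) atTop atTop ∧ (∀ᶠ k in atTop, d.vfloor k ≤ L k) ∧
      ∀ᶠ δ in atTop, ∀ M : ℝ, 0 < M → ∀ᶠ k in atTop,
        (floorSetD d δ k).Nonempty → -1 < thrD d δ k → ∀ t : Fin 2 → ℝ,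
          (∀ f, thrD d δ k < t f) → (∀ f, t f ≤ thrD d δ k + d.a k * M / d.zm k) →
            (∫ U : GaugeConfig 4 (2 * L k + 1) (Matrix.specialUnitaryGroup (Fin 3) ℂ),
                ((wilsonDirac (fundamentalRep (Fin 3)) U 0 1).charpoly.roots.countP
                    (fun z : ℂ => z.im = 0 ∧ -max (t 0) (t 1) < z.re ∧ z.re < -min (t 0) (t 1)) : ℝ) *
                  ∏ f : Fin 2, ‖fermionDet (wilsonDirac (fundamentalRep (Fin 3)) U (t f) 1)‖
                ∂(wilsonMeasure (d := 4) (L := 2 * L k + 1) (fundamentalRep (Fin 3)) (d.β k))) /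
              (∫ U : GaugeConfig 4 (2 * L k + 1) (Matrix.specialUnitaryGroup (Fin 3) ℂ),
                ∏ f : Fin 2, ‖fermionDet (wilsonDirac (fundamentalRep (Fin 3)) U (t f) 1)‖
                ∂(wilsonMeasure (d := 4) (L := 2 * L k + 1) (fundamentalRep (Fin 3)) (d.β k))) ≤ 1 / 4 := by
  obtain ⟨L, hL, hfl, hδ⟩ := h
  refine ⟨L, hL, hfl, hδ.mono fun δ hd M hM => (hd M hM).mono fun k hk hne hthr t ht₁ ht₂ => ?_⟩
  exact windowBody_le_of_windowDOS (d.β k) t (hk hne hthr t ht₁ ht₂)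


/-- **The window law follows from its WEGNER (density-of-states) FORM (`N_f = 2`)** — registered sub-goal
`windowLaw_of_windowDOSLaw_two` of line `Sketch` of the crux `MobilityGap`: if every admissible two-flavour datum carrying
a light moment satisfies the DOS-form law (normalised `t`-integrated phase-quenched zero-window level count of the
Hermitian Wilson operator `γ₅ D_W(U,−s,1)` across the spread window `≤ 2η/4` for all small `η`), then every such datum
satisfies the WINDOW law of the registered stub `stub_windowAt` (`windowAt_of_windowDOSAt`, datum by datum). -/
theorem windowLaw_of_windowDOSLaw_two : (∀ d : LineData 2, LightMomentAt 2 d.a d.β d.s → ∃ L : ℕ → ℕ, Tendsto (fun k => d.a k * (L k : ℝ)) atTop atTop ∧ (∀ᶠ k in atTop, d.vfloor k ≤ L k) ∧ ∀ᶠ δ in atTop, ∀ M : ℝ, 0 < M → ∀ᶠ k in atTop, (floorSetD d δ k).Nonempty → -1 < thrD d δ k → ∀ t : Fin 2 → ℝ, (∀ f, thrD d δ k < t f) → (∀ f, t f ≤ thrD d δ k + d.a k * M / d.zm k) → ∃ η₀ : ℝ, 0 < η₀ ∧ ∀ η : ℝ, 0 < η → η < η₀ → (∫ s in (-max (t 0)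 (t 1))..(-min (t 0) (t 1)), ∫ U : GaugeConfig 4 (2 * L k + 1) (Matrix.specialUnitaryGroup (Fin 3) ℂ), ((spinorLift gammaFive * wilsonDirac (fundamentalRep (Fin 3)) U (-s) 1).charpoly.roots.countP (fun z : ℂ => |z.re| < η) : ℝ) * ∏ f : Fin 2, ‖fermionDet (wilsonDirac (fundamentalRep (Fin 3)) U (t f) 1)‖ ∂(wilsonMeasure (d := 4) (L := 2 * L k + 1) (fundamentalRep (Fin 3)) (d.β k))) / (∫ U : GaugeConfig 4 (2 * L k + 1) (Matrix.specialUnitaryGroup (Fin 3) ℂ), ∏ f : Fin 2, ‖fermionDet (wilsonDirac (fundamentalRep (Fin 3)) U (t f) 1)‖ ∂(wilsonMeasure (d := 4) (L := 2 * L k + 1) (fundamentalRep (Fin 3)) (d.β k))) ≤ 2 * η * (1 / 4)) → ∀ d : LineData 2, LightMomentAt 2 d.a d.β d.s → ∃ L : ℕ → ℕ, Tendsto (fun k => d.a k * (L k : ℝ)) atTop atTop ∧ (∀ᶠ k in atTop, d.vfloor k ≤ L k) ∧ ∀ᶠ δ in atTop, ∀ M : ℝ, 0 < M → ∀ᶠ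 k in atTop, (floorSetD d δ k).Nonempty → -1 < thrD d δ k → ∀ t : Fin 2 → ℝ, (∀ f, thrD d δ k < t f) → (∀ f, t f ≤ thrD d δ k + d.a k * M / d.zm k) → (∫ U : GaugeConfig 4 (2 * L k + 1) (Matrix.specialUnitaryGroup (Fin 3) ℂ), ((wilsonDirac (fundamentalRep (Fin 3)) U 0 1).charpoly.roots.countP (fun z : ℂ => z.im = 0 ∧ -max (t 0) (t 1) < z.re ∧ z.re < -min (t 0) (t 1)) : ℝ) * ∏ f : Fin 2, ‖fermionDet (wilsonDirac (fundamentalRep (Fin 3)) U (t f) 1)‖ ∂(wilsonMeasure (d := 4) (L := 2 * L k + 1) (fundamentalRep (Fin 3)) (d.β k))) / (∫ U : GaugeConfig 4 (2 * L k + 1) (Matrix.specialUnitaryGroup (Fin 3) ℂ), ∏ f : Fin 2, ‖fermionDet (wilsonDirac (fundamentalRep (Fin 3)) U (t f) 1)‖ ∂(wilsonMeasure (d := 4) (L := 2 * L k + 1) (fundamentalRep (Fin 3)) (d.β k))) ≤ 1 / 4 := by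
  intro hDOS d hd
  exact windowAt_of_windowDOSAt (hDOS d hd)

end Summit.QuantumFields.QCD.Theorems.MobilityGapSketch

end
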